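import Summits.SmoothPoincare4.SmoothPoincare4.Theses.VerlindeRLinks
import Literature.Topology.FourManifolds.LinkTubularNbhd
import Literature.Topology.FourManifolds.DehnSurgeryTwistProofs

/-!
# Line `kirby-lemma21`, Stub 1a (`stub_exists_disjoint_framedTubes`): fully disjoint framed tubes
(crux `VerlindeRLinks.VrlComponentsHBallSlice`, item stmt-SmoothPoincare4-15874)

This file states and proves the registered stub `stub_exists_disjoint_framedTubes` (signature verbatim
from the skeleton `Cruxes/VrlComponentsHBallSlice/Lines/kirby_lemma21.lean`): every framed link
`L ⊂ S³` with `n` components has oriented tubular neighbourhoods `νᵢ` of its components realising the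
framings `L.framing i` and with pairwise disjoint (full) ranges — the first datum of the relational
surgery `IsIntegralSurgeryLink` and of the attaching maps of the trace `B⁴ ∪_L (2-handles)`.
Proof: pairwise disjoint tubes exist (`Link.exists_tubularNbhd_pairwise_disjoint`), and each can be
re-framed to any integer without changing its image (`Knot.TubularNbhd.exists_hasFraming_range_eq`,
twisting).

References: D. Rolfsen, *Knots and Links* (1976), §9.F; R. E. Gompf, A. I. Stipsicz, *4-Manifolds and
Kirby Calculus* (1999), §4.5; R. C. Kirby, *The Topology of 4-Manifolds* (1989), Ch. I §2.
-/

noncomputable section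

-- the prescribed namespace `Summit.<P>.<Sub>.…` duplicates `SmoothPoincare4` (P = Sub)
set_option linter.dupNamespace false

open scoped Manifold ContDiff Topology
open Set Function Literature.Topology.FourManifolds

namespace Summit.SmoothPoincare4.SmoothPoincare4.Theorems.VrlComponentsHBallSlice.KirbyLemma21

/-- **Stub 1a of line `kirby-lemma21` — fully disjoint framed tubes** (`stub_exists_disjoint_framedTubes`,
registered signature verbatim).  For every framed link `L ⊂ S³` with `n` components there are oriented
tubular neighbourhoods `νᵢ : S¹ × ℝ² ↪ S³` of the components `L.component i` with framings
`L.framing i` (`Knot.TubularNbhd.HasFraming`) and pairwise disjoint ranges: take pairwise disjoint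
tubes (`Link.exists_tubularNbhd_pairwise_disjoint`; Rolfsen §9.F) and re-frame each one by twisting,
which keeps its image (`Knot.TubularNbhd.exists_hasFraming_range_eq`; Gompf–Stipsicz §4.5).
[cite: Rolfsen1976, §9.F] [cite: GompfStipsicz1999, §4.5] -/
theorem stub_exists_disjoint_framedTubes :
    ∀ (n : ℕ) (L : FramedLink (Fin n)),
      ∃ ν : ∀ i, Knot.TubularNbhd ⇑(L.component i),
        (∀ i, (ν i).HasFraming (L.framing i)) ∧
        Pairwise fun i j => Disjoint (range ⇑(ν i)) (range ⇑(ν j)) := by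
  intro n L
  obtain ⟨ν₀, hdisj⟩ := L.toLink.exists_tubularNbhd_pairwise_disjoint
  choose ν hrange hfr using fun i => (ν₀ i).exists_hasFraming_range_eq (L.framing i)
  refine ⟨ν, hfr, fun i j hij => ?_⟩
  show Disjoint (range ⇑(ν i)) (range ⇑(ν j))
  rw [hrange i, hrange j]
  exact hdisj hij

end Summit.SmoothPoincare4.SmoothPoincare4.Theorems.VrlComponentsHBallSlice.KirbyLemma21

end
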